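import Summits.Ventures.PercRepro.StarGadgetGraphDefs
import Summits.Ventures.PercRepro.GZSwapB

/-!
# The star gadget — the bot configurations are the local ones (graph half, module 2)

Lemma (B) of the graph half: for the star gadget `starGadget cx p q r s`, a configuration `ω` is
`bot` (the three marks pairwise disconnected) iff it is `Local` (at most one open mark edge per
hub, all hubs attached to `x` carry the same mark, and `c – x` open forces that mark to be `c`);
under `Local` the open cluster of a mark `m` is the explicit set `K ω m`, and the open cluster of
the centre, when it attaches to no mark, is `XR ω`.  The tool is the closed-cut lemma
`mem_of_conn_of_closed_boundary`: both sets have no open edge across their boundary.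
-/

namespace PercRepro.StarGadgetGraph

open MultiGraph

variable {cx : Bool} {p q r s : ℕ}



/-! ### Vertices -/

/-- `vm` is injective. -/
theorem vm_inj {m m' : Fin 3} : (vm m : V p q r s) = vm m' ↔ m = m' := by
  simp [vm, Fin.castSucc_inj]

/-- A mark is not the centre. -/
theorem vm_ne_vx (m : Fin 3) : (vm m : V p q r s) ≠ vx := by
  simp only [vm, vx, ne_eq, Sum.inl.injEq]
  fin_cases m <;> decide

/-- A mark is not a hub. -/
theorem vm_ne_inr (m : Fin 3) (h : Hub p q r s) : (vm m : V p q r s) ≠ Sum.inr h := Sum.inl_ne_inr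

/-- The centre is not a hub. -/
theorem vx_ne_inr (h : Hub p q r s) : (vx : V p q r s) ≠ Sum.inr h := Sum.inl_ne_inr

/-! ### The open paths of the gadget -/

/-- An open mark edge joins the mark to its hub. -/
theorem conn_vm_inr_of_markOpen {ω : Config (E cx p q r s)} {h : Hub p q r s} {m : Fin 3}
    (hm : markOpen ω h m) : (starGadget cx p q r s).Conn ω (vm m) (Sum.inr h) := by
  obtain ⟨i, rfl, hi⟩ := hm
  exact Conn.of_openAdj ((starGadget cx p q r s).openAdj_of_open (.inr ⟨h, some i⟩) hi)

/-- An open `x`-edge joins the centre to its hub. -/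
theorem conn_vx_inr_of_xOpen {ω : Config (E cx p q r s)} {h : Hub p q r s} (hx : xOpen ω h) :
    (starGadget cx p q r s).Conn ω vx (Sum.inr h) :=
  Conn.of_openAdj ((starGadget cx p q r s).openAdj_of_open (.inr ⟨h, none⟩) hx)

/-- The open edge `c – x` joins `c` to the centre. -/
theorem conn_c_vx_of_cxOpen {ω : Config (E cx p q r s)} (hc : cxOpen ω) :
    (starGadget cx p q r s).Conn ω (vm 2) vx := by
  obtain ⟨i, hi⟩ := hc
  exact Conn.of_openAdj ((starGadget cx p q r s).openAdj_of_open (.inl i) hi)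

/-- If `x` attaches to `m`, the mark `m` is joined to the centre. -/
theorem conn_vm_vx_of_att {ω : Config (E cx p q r s)} {m : Fin 3} (hA : Att ω m) :
    (starGadget cx p q r s).Conn ω (vm m) vx := by
  rcases hA with ⟨rfl, hc⟩ | ⟨h, hx, hm⟩
  · exact conn_c_vx_of_cxOpen hc
  · exact (conn_vm_inr_of_markOpen hm).trans (conn_vx_inr_of_xOpen hx).symm

/-! ### `bot → Local` -/

/-- In a bot configuration two distinct marks are disconnected. -/
theorem not_conn_vm_of_isBot {ω : Config (E cx p q r s)}
    (hb : (starGadget cx p q r s).IsBot ω (vm 0) (vm 1) (vm 2)) (m m' : Fin 3) (hne : m ≠ m') :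
    ¬ (starGadget cx p q r s).Conn ω (vm m) (vm m') := by
  obtain ⟨h01, h02, h12⟩ := hb
  have h10 : ¬ (starGadget cx p q r s).Conn ω (vm 1) (vm 0) := fun h => h01 h.symm
  have h20 : ¬ (starGadget cx p q r s).Conn ω (vm 2) (vm 0) := fun h => h02 h.symm
  have h21 : ¬ (starGadget cx p q r s).Conn ω (vm 2) (vm 1) := fun h => h12 h.symm
  fin_cases m <;> fin_cases m' <;> simp_all

/-- `bot → Local`: each violated clause gives an open path between two distinct marks. -/
theorem local_of_isBot {ω : Config (E cx p q r s)}
    (hb : (starGadget cx p q r s).IsBot ω (vm 0) (vm 1) (vm 2)) : Local ω := by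
  refine ⟨fun h m m' hm hm' => ?_, fun h h' m m' hx hx' hm hm' => ?_, fun hc h m hx hm => ?_⟩
  · by_contra hne
    exact not_conn_vm_of_isBot hb m m' hne
      ((conn_vm_inr_of_markOpen hm).trans (conn_vm_inr_of_markOpen hm').symm)
  · by_contra hne
    exact not_conn_vm_of_isBot hb m m' hne
      ((conn_vm_inr_of_markOpen hm).trans ((conn_vx_inr_of_xOpen hx).symm.trans
        ((conn_vx_inr_of_xOpen hx').trans (conn_vm_inr_of_markOpen hm').symm)))
  · by_contra hne
    exact not_conn_vm_of_isBot hb m 2 hne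
      ((conn_vm_inr_of_markOpen hm).trans ((conn_vx_inr_of_xOpen hx).symm.trans
        (conn_c_vx_of_cxOpen hc).symm))

/-! ### Membership in `K ω m` and `XR ω` -/

/-- Membership in `K ω m`, unfolded. -/
theorem mem_K_iff {ω : Config (E cx p q r s)} {m : Fin 3} {u : V p q r s} :
    u ∈ K ω m ↔ (u = vm m ∨ ∃ h, u = Sum.inr h ∧ ¬ xOpen ω h ∧ markOpen ω h m) ∨
      (Att ω m ∧ (u = vx ∨ ∃ h, u = Sum.inr h ∧ xOpen ω h)) := by
  simp only [K, Set.mem_union, Set.mem_singleton_iff, Set.mem_setOf_eq]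

/-- The mark `m'` lies in `K ω m` iff `m' = m`. -/
theorem vm_mem_K_iff {ω : Config (E cx p q r s)} {m m' : Fin 3} :
    (vm m' : V p q r s) ∈ K ω m ↔ m' = m := by
  rw [mem_K_iff]
  constructor
  · rintro ((h | ⟨h, hh, -⟩) | ⟨-, h | ⟨h, hh, -⟩⟩)
    · exact vm_inj.1 h
    · exact absurd hh (vm_ne_inr _ _)
    · exact absurd h (vm_ne_vx _)
    · exact absurd hh (vm_ne_inr _ _)
  · rintro rfl
    exact Or.inl (Or.inl rfl)

/-- The centre lies in `K ω m` iff `x` attaches to `m`. -/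
theorem vx_mem_K_iff {ω : Config (E cx p q r s)} {m : Fin 3} :
    (vx : V p q r s) ∈ K ω m ↔ Att ω m := by
  rw [mem_K_iff]
  constructor
  · rintro ((h | ⟨h, hh, -⟩) | ⟨hA, -⟩)
    · exact absurd h.symm (vm_ne_vx _)
    · exact absurd hh (vx_ne_inr _)
    · exact hA
  · intro hA
    exact Or.inr ⟨hA, Or.inl rfl⟩

/-- A hub lies in `K ω m` iff it hangs from `m` with closed `x`-edge, or from the centre when
`x` attaches to `m`. -/
theorem inr_mem_K_iff {ω : Config (E cx p q r s)} {m : Fin 3} {h : Hub p q r s} :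
    (Sum.inr h : V p q r s) ∈ K ω m ↔
      (¬ xOpen ω h ∧ markOpen ω h m) ∨ (Att ω m ∧ xOpen ω h) := by
  rw [mem_K_iff]
  constructor
  · rintro ((h1 | ⟨h', hh, hx, hm⟩) | ⟨hA, h1 | ⟨h', hh, hx⟩⟩)
    · exact absurd h1.symm (vm_ne_inr _ _)
    · obtain rfl := Sum.inr.inj hh
      exact Or.inl ⟨hx, hm⟩
    · exact absurd h1.symm (vx_ne_inr _)
    · obtain rfl := Sum.inr.inj hh
      exact Or.inr ⟨hA, hx⟩
  · rintro (⟨hx, hm⟩ | ⟨hA, hx⟩)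
    · exact Or.inl (Or.inr ⟨h, rfl, hx, hm⟩)
    · exact Or.inr ⟨hA, Or.inr ⟨h, rfl, hx⟩⟩

/-- Membership in `XR ω`, unfolded. -/
theorem mem_XR_iff {ω : Config (E cx p q r s)} {u : V p q r s} :
    u ∈ XR ω ↔ u = vx ∨ ∃ h, u = Sum.inr h ∧ xOpen ω h := by
  simp only [XR, Set.mem_union, Set.mem_singleton_iff, Set.mem_setOf_eq]

/-! ### The closed boundaries -/

/-- Under `Local`, no open edge crosses the boundary of `K ω m`. -/
theorem K_closed {ω : Config (E cx p q r s)} (hL : Local ω) (m : Fin 3) :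
    ∀ e, ω e = true → ((starGadget cx p q r s).fst e ∈ K ω m ↔ (starGadget cx p q r s).snd e ∈ K ω m) := by
  obtain ⟨hL1, hL2, hL3⟩ := hL
  intro e he
  rcases e with i | ⟨h, j⟩
  · have hc : cxOpen ω := ⟨i, he⟩
    show (vm 2 : V p q r s) ∈ K ω m ↔ vx ∈ K ω m
    rw [vm_mem_K_iff, vx_mem_K_iff]
    constructor
    · rintro rfl
      exact Or.inl ⟨rfl, hc⟩
    · rintro (⟨rfl, -⟩ | ⟨h', hx, hm⟩)
      · rfl
      · exact (hL3 hc h' m hx hm).symm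
  · rcases j with _ | i
    · have hx : xOpen ω h := he
      show (vx : V p q r s) ∈ K ω m ↔ Sum.inr h ∈ K ω m
      rw [vx_mem_K_iff, inr_mem_K_iff]
      constructor
      · intro hA
        exact Or.inr ⟨hA, hx⟩
      · rintro (⟨hnx, -⟩ | ⟨hA, -⟩)
        · exact absurd hx hnx
        · exact hA
    · have hm'' : markOpen ω h ((hubType h).marks.get i) := ⟨i, rfl, he⟩
      show (vm ((hubType h).marks.get i) : V p q r s) ∈ K ω m ↔ Sum.inr h ∈ K ω m
      rw [vm_mem_K_iff, inr_mem_K_iff]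
      constructor
      · rintro rfl
        by_cases hx : xOpen ω h
        · exact Or.inr ⟨Or.inr ⟨h, hx, hm''⟩, hx⟩
        · exact Or.inl ⟨hx, hm''⟩
      · rintro (⟨-, hm⟩ | ⟨hA, hx⟩)
        · exact hL1 h _ _ hm'' hm
        · rcases hA with ⟨rfl, hc⟩ | ⟨h', hx', hm'⟩
          · exact hL3 hc h _ hx hm''
          · exact hL2 h h' _ _ hx hx' hm'' hm'

/-- When `x` attaches to no mark, no open edge crosses the boundary of `XR ω`. -/
theorem XR_closed {ω : Config (E cx p q r s)} (hR : ∀ m, ¬ Att ω m) :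
    ∀ e, ω e = true → ((starGadget cx p q r s).fst e ∈ XR ω ↔ (starGadget cx p q r s).snd e ∈ XR ω) := by
  intro e he
  rcases e with i | ⟨h, j⟩
  · exact absurd (show Att ω 2 from Or.inl ⟨rfl, ⟨i, he⟩⟩) (hR 2)
  · rcases j with _ | i
    · have hx : xOpen ω h := he
      show (vx : V p q r s) ∈ XR ω ↔ Sum.inr h ∈ XR ω
      rw [mem_XR_iff, mem_XR_iff]
      exact ⟨fun _ => Or.inr ⟨h, rfl, hx⟩, fun _ => Or.inl rfl⟩
    · have hm : markOpen ω h ((hubType h).marks.get i) := ⟨i, rfl, he⟩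
      show (vm ((hubType h).marks.get i) : V p q r s) ∈ XR ω ↔ Sum.inr h ∈ XR ω
      rw [mem_XR_iff, mem_XR_iff]
      constructor
      · rintro (h1 | ⟨h', h1, -⟩)
        · exact absurd h1 (vm_ne_vx _)
        · exact absurd h1 (vm_ne_inr _ _)
      · rintro (h1 | ⟨h', h1, hx⟩)
        · exact absurd h1.symm (vx_ne_inr _)
        · obtain rfl := Sum.inr.inj h1
          exact absurd (show Att ω _ from Or.inr ⟨h, hx, hm⟩) (hR _)

/-! ### Lemma (B) -/

/-- Under `Local`, two distinct marks are disconnected. -/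
theorem not_conn_vm_of_local {ω : Config (E cx p q r s)} (hL : Local ω) {m m' : Fin 3}
    (hne : m ≠ m') : ¬ (starGadget cx p q r s).Conn ω (vm m) (vm m') := by
  intro hconn
  have hmem : (vm m' : V p q r s) ∈ K ω m :=
    mem_of_conn_of_closed_boundary (K_closed hL m) (vm_mem_K_iff.2 rfl) hconn
  exact hne (vm_mem_K_iff.1 hmem).symm

/-- **Lemma (B), first half**: `bot` is the local condition. -/
theorem isBot_iff (ω : Config (E cx p q r s)) :
    (starGadget cx p q r s).IsBot ω (vm 0) (vm 1) (vm 2) ↔ Local ω :=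
  ⟨local_of_isBot, fun hL =>
    ⟨not_conn_vm_of_local hL (by decide), not_conn_vm_of_local hL (by decide),
      not_conn_vm_of_local hL (by decide)⟩⟩

/-- **Lemma (B), the clusters of the marks**: under `Local`, the open cluster of the mark `m` is
`K ω m`. -/
theorem cluster_mark_eq (ω : Config (E cx p q r s)) (hL : Local ω) (m : Fin 3) :
    (starGadget cx p q r s).cluster ω (vm m) = K ω m := by
  ext u
  constructor
  · intro hu
    exact mem_of_conn_of_closed_boundary (K_closed hL m) (vm_mem_K_iff.2 rfl) hu
  · intro hu
    rw [mem_K_iff] at hu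
    rcases hu with (rfl | ⟨h, rfl, -, hm⟩) | ⟨hA, rfl | ⟨h, rfl, hx⟩⟩
    · exact Conn.refl (starGadget cx p q r s) ω _
    · exact conn_vm_inr_of_markOpen hm
    · exact conn_vm_vx_of_att hA
    · exact (conn_vm_vx_of_att hA).trans (conn_vx_inr_of_xOpen hx)

/-- **Lemma (B), the cluster of the centre in mode R**: when `x` attaches to no mark, its open
cluster is `XR ω`. -/
theorem cluster_x_eq (ω : Config (E cx p q r s)) (hR : ∀ m, ¬ Att ω m) :
    (starGadget cx p q r s).cluster ω vx = XR ω := by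
  ext u
  constructor
  · intro hu
    exact mem_of_conn_of_closed_boundary (XR_closed hR) (mem_XR_iff.2 (Or.inl rfl)) hu
  · intro hu
    rw [mem_XR_iff] at hu
    rcases hu with rfl | ⟨h, rfl, hx⟩
    · exact Conn.refl (starGadget cx p q r s) ω _
    · exact conn_vx_inr_of_xOpen hx

/-- The centre lies in the cluster of `m` iff `x` attaches to `m` (under `Local`). -/
theorem vx_mem_cluster_mark_iff (ω : Config (E cx p q r s)) (hL : Local ω) (m : Fin 3) :
    vx ∈ (starGadget cx p q r s).cluster ω (vm m) ↔ Att ω m := by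
  rw [cluster_mark_eq ω hL m, vx_mem_K_iff]

end PercRepro.StarGadgetGraph
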